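import Mathlib.Topology.Instances.AddCircle.Defs
import Mathlib.Analysis.Normed.Group.AddCircle
import Mathlib.Analysis.SpecialFunctions.Log.Basic
import Mathlib.Data.Finsupp.Basic
import Mathlib.Algebra.BigOperators.Finsupp.Basic
import Mathlib.Algebra.Order.Floor.Defs
import HarnessLib

/-!
# Connes–Consani, Riemann–Roch for `Spec ℤ̄` (2023) and for the ring `ℤ` (2024) — STATEMENT LAYER

Typed reproduction (statements; every object entering the two Riemann–Roch FORMULAS defined with a body,
exactly as printed; NO proof of the published theorems claimed; no axioms) of

* A. Connes, C. Consani, *Riemann–Roch for `\overline{Spec ℤ}`*, Bull. Sci. Math. 187 (2023) 103293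
  (= arXiv:2205.01391) [bib: `ConnesConsani2023RiemannRoch`] — base `𝕊[±1]`, generator `3`;
* A. Connes, C. Consani, *Riemann–Roch for the ring `ℤ`*, C. R. Math. 362 (2024) 229–235
  (= arXiv:2306.00456) [bib: `ConnesConsani2024RiemannRochZ`] — base `𝕊`, generator `−2`.

Cell `pub-rhdoor` (motivic door), seat cc-2 (CC autopsy).  Honest framing: these are Riemann–Roch
theorems for the CURVE `Spec ℤ̄` with INTEGER-valued `H⁰, H¹`-dimensions obtained by counting
(balanced-ternary / negabinary) generators; neither paper defines a surface `Spec ℤ̄ × Spec ℤ̄`, an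
intersection pairing, or anything of Hodge-index type (see the cell's `CC-MAP.md` §4).  Nothing here
is an RH statement.

## What is printed (arXiv page numbers), and how it is typed

**2023, §2 (p. 5).** An Arakelov divisor `D = Σ_j a_j {p_j} + a{∞}` (`a_j ∈ ℤ`, `a ∈ ℝ`, finitely many
primes) ↦ `ArakelovDivisor` (a finitely supported `ℕ →₀ ℤ` on primes, and `inf : ℝ`); the compact
`𝒪(D) = Π_p 𝒪(D)_p × [-e^a, e^a] ⊂ 𝔸_ℚ` with `𝒪(D)_{p_j} = p_j^{-a_j} ℤ_{p_j}`; the lattice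
`L = H⁰(Spec ℤ, 𝒪(D)_f) = {q ∈ ℚ | |q|_ν ≤ exp(D)(ν) ∀ ν ≠ ∞}` (Prop. A.5 eq. (weil6), p. 15), which by
unique factorisation is the fractional ideal `(Π_j p_j^{-a_j}) ℤ` ↦ `ArakelovDivisor.gen`,
`ArakelovDivisor.lattice`; `deg D = Σ a_j log p_j + a` ("the neperian logarithm that is traditionally
used", Intro p. 2) ↦ `ArakelovDivisor.deg`.
**2023, Prop. 2.2 (p. 6).** `H⁰(D) = ‖H L‖_{e^a}`: the `𝕊[±1]`-module `F ↦ {L-valued divisors φ on the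
pointed set F with Σ |φ(x)| ≤ e^a}`; at level `1_+` this is the finite set
`{x ∈ L : |x| ≤ e^a}` ↦ `ArakelovDivisor.H0set`, and a sum `x = Σ_j x_j` "in the sense of (defnsum)"
(eq. (2), p. 5) exists in `‖HL‖_{e^a}` iff `Σ_j |x_j| ≤ e^a`.  `H¹(D) = (H𝔸_ℚ, ℛ)` is the tolerant
module which (Prop. A.5 = Prop. 6.5, p. 15) is the pull-back of `(ℝ/L, d)_{e^a}`: the circle `ℝ/L` with
the metric induced from `ℝ` and tolerance `d(x,y) ≤ e^a`, and `dim H¹(D) = dim (ℝ/L, d)_{e^a}`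
(Prop. 6.5 (ii)) ↦ `AddCircle (gen D)` with Mathlib's quotient norm.
**2023, Def. A.2 = Def. 6.2 (p. 14), the dimension.** `F ⊆ E(1_+)` GENERATES the tolerant
`𝕊[±1]`-module `(E, ℛ)` iff (1) `x ≠ y ∈ F ⇒ (x,y) ∉ ℛ` and (2) every `x ∈ E(1_+)` is `ℛ`-related to
some `y = Σ_F α_j j`, `α_j ∈ {-1,0,1}`, the sum existing in `E`; `dim_{𝕊[±1]}` := least cardinality of a
generating set ↦ `PmGenerates`/`pmDim` (modules `‖HL‖_λ`: `ℛ` = equality, so (1) is void and (2) reads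
`x = Σ α_j j ∧ Σ|α_j j| ≤ λ`, as spelled out in §3 p. 7) and `PmTolGenerates`/`pmTolDim`
(`(A,d)_λ`: (1) reads `d(x,y) > λ`, (2) reads `d(x, Σ α_j j) ≤ λ`, §4 p. 10).
**2023, Prop. 3.3 (i) (p. 7)** `dim_{𝕊[±1]} ‖Hℤ‖_n = ⌈log(2n+1)/log 3⌉` ↦ fact `dim_HZnorm_eq`;
**Prop. 4.1 (p. 10)** `dim_{𝕊[±1]} U(1)_λ = ⌈(−log λ − log 2)/log 3⌉ (λ < ½), 0 (λ ≥ ½)` ↦ fact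
`dim_U1_eq`; the exceptional open set `L + log 2 = ⋃_{k∈ℕ} (k log 3, k log 3 + log(1+3^{-k}))`
(eq. (excL), p. 9) ↦ `excSet`; `⌈x⌉' = ⌈x⌉ (x ≥ 0), −⌈−x⌉ (x ≤ 0)` (eq. (ceilingprime), p. 10) ↦
`oddCeil`; **Theorem 4.3 = Thm. 1.1 (p. 10)**
`dim_{𝕊[±1]} H⁰(D) − dim_{𝕊[±1]} H¹(D) = ⌈(deg D + log 2)/log 3⌉' − 𝟙_L(deg D)` ↦ fact
`RiemannRoch_SpecZbar`.
**2024, §2–5 (pp. 2–6).** Over `𝕊`: `(HA)_X(k_+) = {a ∈ A^k | Σ_Z a_j ∈ X ∀ Z ⊆ k_+}` (Lemma 2.1),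
`H⁰(D) = (HL)_{[-e^a,e^a]}`; generation with `α_j ∈ {0,1}` (Def. 2.1), which for `(Hℤ)_I` reads
"`∃ Z ⊆ G, Σ_Z i = j` and `Σ_{Z'} i ∈ I ∀ Z' ⊆ Z`" (Lemma 3.1) ↦ `SGenerates`/`sDim`, tolerant version ↦
`STolGenerates`/`sTolDim`; `deg₂ := deg / log 2`; `⌈x⌉'` := "the right continuous function which agrees
with ceiling(x) for `x > 0` non-integer and with −ceiling(−x) for `x < 0` non-integer" (Thm. 5.1, p. 6;
there "ceiling" is "the smallest integer `> x`", §3 p. 3), i.e. `⌊x⌋ + 1` for `x ≥ 0` and `⌊x⌋` for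
`x < 0` ↦ `rcCeil`; **Theorem 5.1 = Thm. 1.1 (p. 6)** `dim_𝕊 H⁰(D) − dim_𝕊 H¹(D) = ⌈deg₂ D⌉' + 1` ↦
fact `RiemannRoch_ringZ`.

## Reductions used by the authors (recorded, not re-proved here)

By linear equivalence (Prop. 2.2 (iii)) `D ∼ (deg D){∞}`; then `H⁰(D) ≅ ‖Hℤ‖_n`, `n = ⌊e^{deg D}⌋`
(proof of Thm. 3.4, p. 9) and `dim H¹(D) = dim U(1)_{e^{deg D}}` (proof of Thm. 4.3).  In the typing
below this is the rescaling `x ↦ x / gen D` (`L = gen D · ℤ`, `e^a / gen D = e^{deg D}`), an isometry up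
to the factor `gen D` on both the norm bound and the circle; the facts are stated for general `D` exactly
as printed and the rescaling is left to whoever discharges them.

## Junk values

`pmDim`, `pmTolDim`, `sDim`, `sTolDim` are `sInf` over `ℕ` (value `0` on `∅`); generating sets exist in
every case used (the whole finite set `E(1_+)`; a maximal `λ`-separated finite subset of the compact
circle), so the typed equalities carry exactly the printed content.  `gen D > 0` always.

## Deliberately NOT here

The functorial layer — Γ-sets/`𝕊`-modules as pointed functors `Γ^op → Sets_*`, `𝕊[±1] = 𝕊[μ_{2,+}]`,
the Dold–Kan Γ-space `𝐇(D)` (App. B), the category `Γ𝒯_*` of tolerance modules beyond level `1_+`,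
Serre duality `H⁰(K−D) ≃ Hom(H¹(D), U(1)_{1/4})`, `K = −2{2}` (Thm. 1.2/5.3) and Pontryagin duality
(Prop. 5.2); Prop. 3.3 (ii), Thm. 3.4 (the `deg D ≥ −log 2` half of Thm. 4.3), 2024 Thm. 3.3 and
Prop. 4.2 (the two halves of Thm. 5.1).  The dimensions in both RR formulas depend on these objects only
through the level-`1_+` data typed here (Def. 6.2 is stated at level `1_+`).
-/

noncomputable section

open Set Finset

namespace Literature.NumberTheory.ConnesConsani2023

/-! ## Arakelov divisors on `Spec ℤ̄` (2023 §2, p. 5) -/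

/-- An Arakelov divisor `D = Σ_j a_j {p_j} + a {∞}` on `\overline{Spec ℤ}`: "a formal finite sum with
`a_j ∈ ℤ` and `a ∈ ℝ`, where `p_j` are rational primes" (2023 §2, p. 5).  `fin p = a_p` (zero off a
finite set of primes), `inf = a`. [cite: ConnesConsani2023RiemannRoch, §2 p. 5] -/
structure ArakelovDivisor where
  /-- the finite part `p ↦ a_p`, a finitely supported integer-valued function -/
  fin : ℕ →₀ ℤ
  /-- supported on primes -/
  prime_of_mem_support : ∀ p ∈ fin.support, Nat.Prime p
  /-- the coefficient `a` of `{∞}` -/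
  inf : ℝ

namespace ArakelovDivisor

/-- The Arakelov degree `deg D = Σ_j a_j log p_j + a` (natural logarithm; Intro p. 2, §3 Thm. 3.4:
`e^{deg D}` is the norm bound after reduction to `D ∼ (deg D){∞}`).
[cite: ConnesConsani2023RiemannRoch, Intro p. 2] -/
def deg (D : ArakelovDivisor) : ℝ :=
  (D.fin.sum fun p a => (a : ℝ) * Real.log p) + D.inf

/-- The positive rational generator `Π_j p_j^{-a_j}` of the lattice
`L = H⁰(Spec ℤ, 𝒪(D)_f) = {q ∈ ℚ | |q|_p ≤ p^{a_p} ∀ p} = (Π_j p_j^{-a_j}) ℤ`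
(2023 Prop. A.5 eq. (weil6), p. 15; `𝒪(D)_{p_j} = p_j^{-a_j} ℤ_{p_j}`, §2 p. 5), viewed in `ℝ`.
[cite: ConnesConsani2023RiemannRoch, Prop. 6.5 p. 15] -/
def gen (D : ArakelovDivisor) : ℝ :=
  D.fin.prod fun p a => (p : ℝ) ^ (-a)

/-- The lattice `L = H⁰(Spec ℤ, 𝒪(D)_f) ⊂ ℚ ⊂ ℝ` of rational numbers with `|q|_p ≤ p^{a_p}` for all
primes `p`, i.e. `gen D · ℤ` (2023 eq. (weil6), p. 15). [cite: ConnesConsani2023RiemannRoch, Prop. 6.5 p. 15] -/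
def lattice (D : ArakelovDivisor) : Set ℝ :=
  {x | ∃ m : ℤ, x = (m : ℝ) * D.gen}

/-- `H⁰(D)` at level `1_+`: the finite set `ℚ ∩ 𝒪(D) = {x ∈ L : |x| ≤ e^a}` underlying the
`𝕊[±1]`-module `H⁰(D) = ‖H L‖_{e^a}` (2023 Prop. 2.2 (i), p. 6; Intro p. 3: "keeps track of the
partially defined addition in `I = ‖Hℤ‖_{e^a}(1_+) = [-e^a, e^a] ∩ ℤ`").
[cite: ConnesConsani2023RiemannRoch, Prop. 2.2 (i) p. 6] -/
def H0set (D : ArakelovDivisor) : Set ℝ :=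
  {x | x ∈ D.lattice ∧ |x| ≤ Real.exp D.inf}

end ArakelovDivisor

/-! ## Dimensions over `𝕊[±1]` (2023 Def. 6.2 p. 14, §3 p. 7, §4 p. 10) -/

/-- Generation over `𝕊[±1]` for the normed module `‖H L‖_λ` with level-`1_+` set `E = {x ∈ L : |x| ≤ λ}`
(2023 Def. 6.2 with the trivial tolerance, as spelled out in §3 p. 7): `F ⊆ E` generates iff every
`x ∈ E` is `x = Σ_{j∈F} α_j j` with `α_j ∈ {-1, 0, 1}` AND `Σ_{j∈F} |α_j j| ≤ λ` (the sum exists in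
`‖HL‖_λ`, eq. (2) p. 5).  Coefficients are typed as a function `α : ℝ → ℤ` read on `F` only.
[cite: ConnesConsani2023RiemannRoch, Def. 6.2 p. 14; §3 p. 7] -/
def PmGenerates (E : Set ℝ) (lam : ℝ) (F : Finset ℝ) : Prop :=
  (↑F ⊆ E) ∧
    ∀ x ∈ E, ∃ α : ℝ → ℤ, (∀ j ∈ F, α j = -1 ∨ α j = 0 ∨ α j = 1) ∧
      x = ∑ j ∈ F, (α j : ℝ) * j ∧ ∑ j ∈ F, |(α j : ℝ) * j| ≤ lam

/-- `dim_{𝕊[±1]}` of `‖HL‖_λ` with level-`1_+` set `E`: "the minimal cardinality of a generating set"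
(2023 Def. 6.2 p. 14; §3 p. 7).  An `sInf` over `ℕ` (see module docstring, Junk values).
[cite: ConnesConsani2023RiemannRoch, Def. 6.2 p. 14] -/
def pmDim (E : Set ℝ) (lam : ℝ) : ℕ :=
  sInf {k : ℕ | ∃ F : Finset ℝ, F.card = k ∧ PmGenerates E lam F}

/-- Generation over `𝕊[±1]` for the tolerant module `(A, d)_λ` of an abelian group with translation
invariant metric (2023 Prop. 6.3, Def. 6.2 p. 14, as used in §4 p. 10): `F ⊆ A` generates iff
(1) distinct elements of `F` are NOT `λ`-close, `d(x,y) > λ`, and (2) every `x ∈ A` is within `λ` of some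
`Σ_{j∈F} α_j j`, `α_j ∈ {-1,0,1}`. [cite: ConnesConsani2023RiemannRoch, Def. 6.2 p. 14; §4 p. 10] -/
def PmTolGenerates {A : Type*} [SeminormedAddCommGroup A] (lam : ℝ) (F : Finset A) : Prop :=
  (∀ x ∈ F, ∀ y ∈ F, x ≠ y → lam < dist x y) ∧
    ∀ x : A, ∃ α : A → ℤ, (∀ j ∈ F, α j = -1 ∨ α j = 0 ∨ α j = 1) ∧
      dist x (∑ j ∈ F, α j • j) ≤ lam

/-- `dim_{𝕊[±1]} (A, d)_λ`: minimal cardinality of a generating set (2023 Def. 6.2 p. 14).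
[cite: ConnesConsani2023RiemannRoch, Def. 6.2 p. 14] -/
def pmTolDim (A : Type*) [SeminormedAddCommGroup A] (lam : ℝ) : ℕ :=
  sInf {k : ℕ | ∃ F : Finset A, F.card = k ∧ PmTolGenerates lam F}

/-- The level-`1_+` set of `‖Hℤ‖_n`: `[-n, n] ∩ ℤ` inside `ℝ` (2023 §3, p. 7).
[cite: ConnesConsani2023RiemannRoch, §3 p. 7] -/
def HZball (n : ℕ) : Set ℝ :=
  {x | (∃ m : ℤ, x = (m : ℝ)) ∧ |x| ≤ n}

/-- `dim_{𝕊[±1]} H⁰(D) := dim_{𝕊[±1]} ‖H L‖_{e^a}` (2023 Prop. 2.2 (i), Def. 6.2).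
[cite: ConnesConsani2023RiemannRoch, Prop. 2.2 (i) p. 6] -/
def dimH0 (D : ArakelovDivisor) : ℕ :=
  pmDim D.H0set (Real.exp D.inf)

/-- `dim_{𝕊[±1]} H¹(D) := dim_{𝕊[±1]} (ℝ/L, d)_{e^a}` (2023 Prop. 6.5 (ii), p. 15), `ℝ/L` the circle
`ℝ/(gen D)ℤ` with the metric induced from `ℝ` (Mathlib `AddCircle (gen D)`, quotient norm).
[cite: ConnesConsani2023RiemannRoch, Prop. 6.5 (ii) p. 15] -/
def dimH1 (D : ArakelovDivisor) : ℕ :=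
  pmTolDim (AddCircle D.gen) (Real.exp D.inf)

/-- The exceptional open set `L ⊂ ℝ` of finite measure (2023 eq. (excL), p. 9):
`L + log 2 = ⋃_{k ∈ ℕ} (k log 3, k log 3 + ε_k)`, `ε_k = log(1 + 3^{-k})`; equivalently (Intro)
`L = ⋃_k (log(3^k/2), log((3^k+1)/2))`, `|L| = log Π_{k≥0}(1+3^{-k}) = 1.14099…`.
[cite: ConnesConsani2023RiemannRoch, eq. (24) p. 9] -/
def excSet : Set ℝ :=
  ⋃ k : ℕ, Ioo ((k : ℝ) * Real.log 3 - Real.log 2)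
    ((k : ℝ) * Real.log 3 + Real.log (1 + (3 : ℝ) ^ (-(k : ℤ))) - Real.log 2)

/-- The odd ceiling `⌈x⌉' = ⌈x⌉` for `x ≥ 0`, `= −⌈−x⌉` for `x ≤ 0` (2023 eq. (ceilingprime), p. 10;
Intro: "the odd function on `ℝ` that agrees with the ceiling function on positive reals").
[cite: ConnesConsani2023RiemannRoch, eq. (27) p. 10] -/
def oddCeil (x : ℝ) : ℤ :=
  if 0 ≤ x then ⌈x⌉ else -⌈-x⌉

/-! ## The 2023 statements (named facts, no proof claimed) -/

/-- **2023 Proposition 3.3 (i)** (p. 7; NAMED FACT): for every integer `n ≥ 0`,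
`dim_{𝕊[±1]} ‖Hℤ‖_n = ⌈log(2n+1)/log 3⌉` (lower bound: `3^{#F} ≥ 2n+1`; upper bound: balanced ternary,
Lemma 3.1, with a repair on the exceptional set `E = {3^ℓ + (3^m−1)/2}`).
[cite: ConnesConsani2023RiemannRoch, Prop. 3.3 (i) p. 7] -/
def dim_HZnorm_eq : Prop :=
  ∀ n : ℕ, (pmDim (HZball n) n : ℤ) = ⌈Real.log (2 * n + 1) / Real.log 3⌉

/-- **2023 Proposition 4.1** (p. 10; NAMED FACT): for `λ > 0`, with `U(1) = ℝ/ℤ` and its length-one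
metric, `dim_{𝕊[±1]} U(1)_λ = ⌈(−log λ − log 2)/log 3⌉` if `λ < 1/2` and `= 0` if `λ ≥ 1/2`.
[cite: ConnesConsani2023RiemannRoch, Prop. 4.1 p. 10] -/
def dim_U1_eq : Prop :=
  ∀ lam : ℝ, 0 < lam →
    (lam < 1 / 2 →
      (pmTolDim (AddCircle (1 : ℝ)) lam : ℤ) = ⌈(-Real.log lam - Real.log 2) / Real.log 3⌉) ∧
    (1 / 2 ≤ lam → pmTolDim (AddCircle (1 : ℝ)) lam = 0)

/-- **2023 Theorem 4.3 = Theorem 1.1, Riemann–Roch for `\overline{Spec ℤ}` over `𝕊[±1]`** (p. 10;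
NAMED FACT).  As printed: "Let `D` be an Arakelov divisor on `\overline{Spec ℤ}`. Then
`dim_{𝕊[±1]} H⁰(D) − dim_{𝕊[±1]} H¹(D) = ⌈(deg D + log 2)/log 3⌉' − 𝟙_L`", `𝟙_L` the characteristic
function of the exceptional open set `L` evaluated at `deg D` (proof of Thm. 3.4), `⌈·⌉'` the odd
ceiling. [cite: ConnesConsani2023RiemannRoch, Thm. 4.3 p. 10 (= Thm. 1.1 p. 2)] -/
def RiemannRoch_SpecZbar : Prop :=
  ∀ D : ArakelovDivisor,
    (dimH0 D : ℤ) - (dimH1 D : ℤ) =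
      oddCeil ((D.deg + Real.log 2) / Real.log 3) - excSet.indicator (fun _ => (1 : ℤ)) D.deg

/-! ## Over the absolute base `𝕊` (2024) -/

/-- Generation over `𝕊` for `(HL)_X`, `X = {x ∈ L : |x| ≤ λ}` (2024 Lemma 2.1, Def. 2.1, Lemma 3.1,
pp. 2–3): `G ⊆ X` generates iff every `x ∈ X` is `Σ_{i∈Z} i` for some `Z ⊆ G` all of whose partial sums
stay in `X` (`|Σ_{Z'} i| ≤ λ` for every `Z' ⊆ Z`; membership in `L` is automatic).
[cite: ConnesConsani2024RiemannRochZ, Lemma 3.1 p. 3] -/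
def SGenerates (E : Set ℝ) (lam : ℝ) (G : Finset ℝ) : Prop :=
  (↑G ⊆ E) ∧ ∀ x ∈ E, ∃ Z ⊆ G, ∑ i ∈ Z, i = x ∧ ∀ Z' ⊆ Z, |∑ i ∈ Z', i| ≤ lam

/-- `dim_𝕊 (HL)_X`: minimal cardinality of an `𝕊`-generating set (2024 Def. 2.1, p. 3).
[cite: ConnesConsani2024RiemannRochZ, Def. 2.1 p. 3] -/
def sDim (E : Set ℝ) (lam : ℝ) : ℕ :=
  sInf {k : ℕ | ∃ G : Finset ℝ, G.card = k ∧ SGenerates E lam G}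

/-- Generation over `𝕊` for the tolerant module `(A,d)_λ` (2024 Def. 2.1 with `α_j ∈ {0,1}`, §4 p. 5):
distinct elements of `F` are not `λ`-close, and every `x` is within `λ` of a subset sum of `F`.
[cite: ConnesConsani2024RiemannRochZ, Def. 2.1 p. 3; §4 p. 5] -/
def STolGenerates {A : Type*} [SeminormedAddCommGroup A] (lam : ℝ) (F : Finset A) : Prop :=
  (∀ x ∈ F, ∀ y ∈ F, x ≠ y → lam < dist x y) ∧ ∀ x : A, ∃ Z ⊆ F, dist x (∑ j ∈ Z, j) ≤ lam

/-- `dim_𝕊 (A, d)_λ` (2024 Def. 2.1, p. 3). [cite: ConnesConsani2024RiemannRochZ, Def. 2.1 p. 3] -/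
def sTolDim (A : Type*) [SeminormedAddCommGroup A] (lam : ℝ) : ℕ :=
  sInf {k : ℕ | ∃ F : Finset A, F.card = k ∧ STolGenerates lam F}

/-- `dim_𝕊 H⁰(D)`, `H⁰(D) = (HL)_{[-e^a, e^a]}` (2024 §2 and proof of Thm. 3.3, p. 5).
[cite: ConnesConsani2024RiemannRochZ, Thm. 3.3 p. 5] -/
def sDimH0 (D : ArakelovDivisor) : ℕ :=
  sDim D.H0set (Real.exp D.inf)

/-- `dim_𝕊 H¹(D) = dim_𝕊 (ℝ/L, d)_{e^a}` (2024 §4 p. 5, referring to 2023 App. A–B).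
[cite: ConnesConsani2024RiemannRochZ, §4 p. 5] -/
def sDimH1 (D : ArakelovDivisor) : ℕ :=
  sTolDim (AddCircle D.gen) (Real.exp D.inf)

/-- The right-continuous ceiling `⌈x⌉'` of 2024 Thm. 5.1 (p. 6): it "agrees with ceiling(x) for `x > 0`
non-integer and with −ceiling(−x) for `x < 0` non-integer", right-continuously extended, where the 2024
paper's "ceiling" is "the smallest integer `> x`" (§3 p. 3); explicitly `⌊x⌋ + 1` for `x ≥ 0` and `⌊x⌋`
for `x < 0` (checked against the proofs of Thm. 3.3 and Thm. 5.1: `χ = n + 1` for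
`n − 1 ≤ deg₂ D < n`, `χ = −m` for `deg₂ D ∈ [−m−1, −m)`).
[cite: ConnesConsani2024RiemannRochZ, Thm. 5.1 p. 6] -/
def rcCeil (x : ℝ) : ℤ :=
  if 0 ≤ x then ⌊x⌋ + 1 else ⌊x⌋

/-- **2024 Theorem 5.1 = Theorem 1.1, Riemann–Roch for the ring `ℤ` over `𝕊`** (p. 6; NAMED FACT).
As printed: "Let `D` be an Arakelov divisor on `\overline{Spec ℤ}`. Then
`dim_𝕊 H⁰(D) − dim_𝕊 H¹(D) = ⌈deg₂ D⌉' + 1`", `deg₂ := deg / log 2`, `⌈·⌉'` = `rcCeil`.  ("Formula (1)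
displays a perfect analogy with the Riemann–Roch formula holding for curves of genus 0", Intro p. 2.)
[cite: ConnesConsani2024RiemannRochZ, Thm. 5.1 p. 6 (= Thm. 1.1 p. 2)] -/
def RiemannRoch_ringZ : Prop :=
  ∀ D : ArakelovDivisor,
    (sDimH0 D : ℤ) - (sDimH1 D : ℤ) = rcCeil (D.deg / Real.log 2) + 1

/-! ## Elementary API (proved) -/

/-- The lattice generator is positive (each `p` in the support is a prime, so `p^{-a_p} > 0`). [folklore] -/
theorem ArakelovDivisor.gen_pos (D : ArakelovDivisor) : 0 < D.gen := by
  unfold ArakelovDivisor.gen Finsupp.prod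
  refine Finset.prod_pos fun p hp => ?_
  have hp' : 0 < (p : ℝ) := by exact_mod_cast (D.prime_of_mem_support p hp).pos
  exact zpow_pos hp' _

/-- The archimedean divisor `a{∞}`: no finite part. [cite: ConnesConsani2023RiemannRoch, §2 p. 5] -/
def ArakelovDivisor.archimedean (a : ℝ) : ArakelovDivisor where
  fin := 0
  prime_of_mem_support := by simp
  inf := a

/-- `deg (a{∞}) = a` and its lattice is `ℤ` (`gen = 1`), so `H⁰(a{∞})(1_+) = [-e^a, e^a] ∩ ℤ` as in the
Intro p. 3. [cite: ConnesConsani2023RiemannRoch, Intro p. 3] -/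
theorem ArakelovDivisor.deg_archimedean (a : ℝ) :
    (ArakelovDivisor.archimedean a).deg = a ∧ (ArakelovDivisor.archimedean a).gen = 1 := by
  simp [ArakelovDivisor.deg, ArakelovDivisor.gen, ArakelovDivisor.archimedean]

/-- The odd ceiling is odd where it matters: `⌈x⌉' = ⌊x⌋` for `x < 0` (so `−dim H¹` appears with the
floor, as in the proof of Thm. 4.3). [folklore] -/
theorem oddCeil_of_neg {x : ℝ} (hx : x < 0) : oddCeil x = ⌊x⌋ := by
  simp [oddCeil, not_le.mpr hx, Int.ceil_neg]

end Literature.NumberTheory.ConnesConsani2023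

end
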